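import Summits.QuantumFields.YangMills.Theorems.UnitScaleTiltProp7SecondOrderDictT3
import Summits.QuantumFields.YangMills.Theorems.UnitScaleTiltProp7NMax19Algebra
import HarnessLib

/-!
# Route `UnitScaleTilt`, crux «MinimiserStabilityRegPr» (stmt-QuantumFields-19200, stub EX, route (α)) — ROW `hΔsol` OF ★★OWNER RULING g27-№7 (3) REDUCED TO NAMED
# N06 LETTERS AT THE T³ MEMBER: [Balaban1985Variational] (133) ⇒ (136) — «|Δ_{U₀}A′₁| < O(1)C₁B₃ε₁(Lʲη)⁻³» — and its `D*D` companion, for a one-form `Y = ι(A′₁)` on the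
# route carrier, FROM print's displayed inputs (28)∕(3.137)∕(97)∕(3.49)∕(3.69)∕(130) written as pointwise rows in the `nMax19` letters, the Weitzenböck identity (135)
# and the (14)-clause being THEOREMS (✓`Prop7SecondOrderDict`)

Cell `ym3-torus` (HUMAN RULING D-0037, YM ladder rung R3 — YM₃ on T³, NOT d = 4, NOT Clay; YM gap NOT proved), width seat `ym3-torus-px16` (explicit-unit; ★w2-19200 g5
NAMER GO (G1) 16:38:05Z «`hΔsol_of_rows` AFTER hDict2, SIGNATURE first, each displayed N06 row with a one-line inhabitability check»; `--supports stmt-QuantumFields-19200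
--as helper`, count-neutral; NO claim on crux∕stub∕registry).  THEOREMS ONLY (0 `def`, 0 `sorry`).  CONDITIONAL: every analytic input of print's (136) is a DISPLAYED
hypothesis with its supplier named; what is PROVED is that they compose, in the route's letters and with print's O(1) explicit, to the two second-order members of
`Prop7TPrint.nMax19` for the `A′₁`-piece (LOCATE `LOCATE-HDSOL-136-px16.md` = 19200 evidence #52, §1 (E1)–(E11), §3).

THE PRINT ([Balaban1985Variational] p. 298, verbatim): «(Δ + DRD*)A₀ = −P₀*J + P₀*Δ⁽²⁾A′₁ − P₀*((δ∕δA′)V)(A′₁). (133)  The bound (28), the inequality (3.137) [5] for the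
operator Δ⁽²⁾, the inequality (97) of Proposition 4, and the bounds |A′₁|₍₋₁₎, |∇A′₁|₍₋₂₎ < ½B₁C₁B₃ε₁ imply that the right-hand side of (133) can be estimated by
O(1)C₁B₃ε₁(Lʲη)⁻³ on Ω_j.  The configuration A₀ = A′₁ − H₀B satisfies similar bounds as A′₁, and we have (Δ + DRD*)A₀ = (D*D + DD*)A₀ + (Δ′ − DPD*)A₀, (134) (D*DA₀)_μ(x) +
(DD*A₀)_μ(x) = (Δ_{U₀}A₀,μ)(x) − Σ_ν R(…)·η⁻²[R(U₀(∂p′_μν(x))) − 1]A_ν(…), (135) … The bound for this operator follows from the inequality (3.49) [5] for DPD*, the inequality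
(3.69) [5] for Δ′, and the regularity condition (14) for the configuration U₀.  This together with (133) … implies the bound |Δ_{U₀}A₀|₍₋₃₎ < O(1)C₁B₃ε₁, hence finally
the bound |Δ_{U₀}A′₁| < O(1)C₁B₃ε₁(Lʲη)⁻³ on Ω_j, j = 0, 1, …, k. (136)»; (130) p. 298 «|Δ_{U₀}H₀B|₍₋₃₎ ≤ B₀|B|»; p. 299 (140) «we use again the formula (135), and the fact
that DPD* is a bounded operator».

THE READING AT THE ONE-LEVEL T³ MEMBER (`η = eta F n K = L^{−(K−n)}`, `Lʲη = 1`, all (−n)-weights `1` — ✓`Prop7SectET3Transport.levWeight_const_eq_one`; the regularity radius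
`ε₀` of `RegPr F n K ε₀ U₀` plays print's `C₁B₃ε₁`).  One-forms are read on the route carrier `PBond (F.P K) 0 → M₂(ℂ)` in print's A-UNITS (`Y = ι(A′₁)`, sup-size `n`;
`Y0 = ι(A₀)`, sup-size `m`; `YH = ι(H₀B)`); the UNIT-lattice operators of `nMax19` (`covCodiffCurlT 1`, `covLapFormT 1`, `covDerivFwdT 1 ∘ covDivFormT 1` at `bgUnits F K U₀`)
are `η²` times print's `η`-operators, so every printed (−3)-bound «≤ c» becomes the pointwise row «≤ c·η²».

DISPLAYED ROWS (hypotheses; print locus → supplier → ONE-LINE INHABITABILITY CHECK per ★★OWNER RULING g27-№9 (3)):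
* `hsplit : Y = Y0 + YH` — (129) `A′₁ = A₀ + H₀B` → the supplier sets `YH := ι(H₀B)`, `H₀ = HT` at the `Δ_a`-slot (✓`Prop7SectET3CurvedPropagators.HT`), `Y0 := Y − YH` → CHECK: definitional (`Y0 := Y − YH`).
* `h133 : ∀ μ x, D¹*D¹Y0 + D¹(D¹*Y0) = −J′ + X₂ − X₃ − Yop` (route letters) — (133)+(134) with `J′ = η²·P₀*J`, `X₂ = η²·P₀*Δ⁽²⁾A′₁`, `X₃ = η²·P₀*V′(A′₁)`, `Yop = η²·(Δ′ − DPD*)A₀` read on the carrier →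
  supplier: the (128)⇒(133) algebra at the member (lit ✓`B11Eq131Projection.eq133_weak`, ℂ-port free per ym-t4-w12 16:29:52Z) fed by `hCrit127` (★px21's binder) + ✓`laplaceA_GT`∕✓`Qk_HT` +
  lit ✓`B11Eq135Weitzenbock.eq134` → CHECK: an IDENTITY DEFINING `Yop` once `J′ X₂ X₃` are chosen (`Yop := −J′ + X₂ − X₃ − LHS`), so inhabited for every datum; content sits in the bound rows.
* `hJ : ‖J′ μ x‖ ≤ p·cJ·ε₀·η²` — (28) `|J|₍₋₃₎ ≤ C₁B₃ε₁` (✓`Prop7SectET3ObjectsPd.inU2cur_of_regPr` ∕ lit ✓`B11Eq98CurrentSlot.norm_Jcur_le`) × `‖P₀*‖ ≤ p` ((E3), [5] Thm 3.3 n = 0 + `(QGQ*)⁻¹`; N06) →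
  CHECK: at `U₀ = 1` `J = 0`, row holds with any `p, cJ ≥ 0`; on `RegPr` by the two named suppliers.
* `hX₂ : ‖X₂ μ x‖ ≤ p·θ₂·n·η²` — (3.137) [5] for `Δ⁽²⁾` (lit ✓`B9Ineq3137Regular.ineq3137a_printed_of_regular`; N06 at the member) × `p` → CHECK: `Δ⁽²⁾ = 0` at `U₀ = 1` (`J = 0`), row trivial there.
* `hX₃ : ‖X₃ μ x‖ ≤ p·C₄·n²·η²` — (97) Prop. 4 = the EX knit's own displayed `prop4` (`QuadAnalytic (Wf L i U₀) (C₄ L) (a₃ L)`) × `p` → CHECK: inhabited by ✓`Prop7SectET3Prop4.exists_prop4Hyp_W80_latticeFree`'s currency.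
* `hn : n ≤ B₁∕2·ε₀`, `hYsup : ‖Y b‖ ≤ n` — (E7) `|A′₁|₍₋₁₎ < ½B₁C₁B₃ε₁` (the knit's `‖A₁‖ < r` + `norm_H₁`·`‖B‖`) → CHECK: `Y = 0`.
* `hYop : ‖Yop μ x‖ ≤ bop·m·η²`, `hm0 : ‖Y0 b‖ ≤ m`, `hm : m ≤ s·ε₀` — (3.49) `DPD*` + (3.69) `Δ′` [5] at `A₀` (N06; lit def-Props `B9.Stmt349Printed`, rows B9.Eq3.69) and «A₀ satisfies similar
  bounds» ((3.133) n = 0 for `H₀` + `|B|`) → CHECK: `Y0 = 0`, `Yop = 0`.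
* `h130 : ‖Δ¹YH ν x‖ ≤ BΔ·nB·η²`, `hB : nB ≤ cB·ε₀` — (130) = [5] Thm 3.3 (3.42) n = 3 for `G∘Q*(QGQ*)⁻¹` (THE L-sized N06 row; no tree decl at the member for the global `G`) and (20)∕(75)
  `|B| < 2dLC₁ε₁` (`CloseAvg`) → CHECK: `YH = 0`, `nB = 0`.
* (for the `D*D` member only) `hDDY : ‖D¹(D¹*Y) μ x‖ ≤ k₄·n·η²` — (3.49) for `DP_SD*` at `Y` using (21) `R_SD*Y = 0 ⇒ DD*Y = DP_SD*Y` (✓`Prop7LandauDict.isLandauPrintS_iff_covDivFormT` reads (21)) →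
  CHECK: `Y = 0`; on Landau fields by the (3.49) supplier.
WHAT IS PROVED: ★★`norm_covLapFormT_le_of_rows136` — `‖(Δ¹_{U₀}Y)_ν(x)‖ ≤ (p(cJ + θ₂B₁∕2 + C₄B₁²ε₀∕4) + (bop + 4ε₀)s + BΔ·cB)·ε₀·η²` ((136) with print's O(1) composed as in
lit ✓`B11Carve14SectEHyp.rhs133_bound`∕`lapA0_bound`∕`ineq136`, the (135)+(14) step being ✓`Prop7SecondOrderDict.covLapFormT_eq_covCodiffCurlT_add` +
✓`norm_curvOp_formComp_le`); ★★`norm_covCodiffCurlT_le_of_rows136` — the `D¹*D¹` member `≤ (that + k₄B₁∕2 + 2B₁ε₀)·ε₀·η²` via ✓`norm_covCodiffCurlT_sub_covLapFormT_add_gradDiv_le_of_regPr`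
((140)'s mechanism applied to `A′₁`).  So `hΔsol` = {`h133`'s feeders: `hCrit127` + (E2) algebra} + {N06: `p`, `θ₂`, `bop`, `BΔ`, `k₄` rows} + {in-cell: (28), `prop4`, sizes} — nothing else.

HONEST SCOPE.  Triangle inequalities over landed identities; the rows ARE the content and are NOT proved here; constants crude (print's O(1) «depending on d and L only» =
through the row constants, G-B11-05).  Not a proof of any stub; nothing continuum ∕ OS ∕ mass-gap ∕ Clay.

References: T. Bałaban, CMP **102** (1985) 277–309 [Balaban1985Variational] ((19) p.281, (21) p.281, (28) p.282, (97) p.293, (129)–(136) pp.297–298, (140) p.299, (14) p.280);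
CMP **99** (1985) 389–434 [Balaban1985BackgroundPropagators] ((3.42) p.397, (3.49) p.399, (3.69) p.404, (3.137) p.424).
-/

set_option autoImplicit false

noncomputable section

open scoped Matrix.Norms.L2Operator

namespace Summit.QuantumFields.YangMills.Theorems.Prop7HDsolOfRows

open Literature.MathematicalPhysics.QuantumFieldTheory.Balaban1983to89
open Literature.MathematicalPhysics.QuantumFieldTheory.Balaban1983to89.T3ContinuumYM3Torus
open Literature.MathematicalPhysics.QuantumFieldTheory.Balaban1983to89.T3PrintedRegularMinimiser (RegPr)
open T3SectALandauChart (covDerivFwdT formComp covCodiffCurlT covLapFormT covDivFormT bgUnits eta eta_pos)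
open B9Eq39Adjoint (covD covDstar)
open B11Eq135Weitzenbock (vecLap curvOp)
open B9TorusCalculus (torusT)
open Summit.QuantumFields.YangMills.Theorems.Prop7SecondOrderDict

variable (F : T3Family) (n K : ℕ)

/-! ## §1 (133) ⇒ (136) at the member, rows displayed

Linearity of the letters (the split (129) `Y = Y0 + YH`) is ✓`Prop7NMax19Algebra.covLapFormT_add` (★px14, p650298). -/

/-- ★★ **(136) FOR THE `A′₁`-PIECE AT THE T³ MEMBER FROM THE DISPLAYED ROWS** — the covariant-Laplacian member of (19)∕`nMax19`:
`‖(Δ¹_{U₀}Y)_ν(x)‖ ≤ (p·(cJ + θ₂B₁∕2 + C₄B₁²ε₀∕4) + (bop + 4ε₀)·s + BΔ·cB)·ε₀·η²` for `Y = Y0 + YH` on a printed-regular background, from (133)+(134) as a route-letter identity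
(`h133`), the bound rows (28)∕(3.137)∕(97) behind `P₀*` (`hJ hX₂ hX₃`, sizes `hn`), «A₀ similar bounds» + (3.49)∕(3.69) (`hYop hm0 hm`), (130) + `|B|` (`h130 hB`); the (135) + (14)
step is ✓`Prop7SecondOrderDict.covLapFormT_eq_covCodiffCurlT_add` + ✓`norm_curvOp_formComp_le`. [cite: Balaban1985Variational, (133)–(136) p.298, (130) p.298, (28) p.282, (97) p.293, (14) p.280; Balaban1985BackgroundPropagators, (3.137) p.424, (3.49) p.399, (3.69) p.404, (3.42) p.397] -/
theorem norm_covLapFormT_le_of_rows136 {ε₀ : ℝ} (hε₀ : 0 ≤ ε₀) (U₀ : GaugeField (F.P K) 0 (Matrix.specialUnitaryGroup (Fin 2) ℂ)) (hU₀ : RegPr F n K ε₀ U₀)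
    (Y Y0 YH : PBond (F.P K) 0 → Matrix (Fin 2) (Fin 2) ℂ) (hsplit : Y = Y0 + YH)
    (J' X₂ X₃ Yop : Fin (F.P K).d → Site (F.P K) 0 → Matrix (Fin 2) (Fin 2) ℂ)
    (h133 : ∀ (μ : Fin (F.P K).d) (x : Site (F.P K) 0),
      covCodiffCurlT 1 (bgUnits F K U₀) Y0 μ x + covDerivFwdT 1 (bgUnits F K U₀) μ (covDivFormT 1 (bgUnits F K U₀) Y0) x
        = -J' μ x + X₂ μ x - X₃ μ x - Yop μ x)
    {p cJ θ₂ C₄ B₁ nY bop m s BΔ nB cB : ℝ} (hp : 0 ≤ p) (hθ₂ : 0 ≤ θ₂) (hC₄ : 0 ≤ C₄) (hnY : 0 ≤ nY) (hbop : 0 ≤ bop) (hBΔ : 0 ≤ BΔ)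
    (hJ : ∀ μ x, ‖J' μ x‖ ≤ p * cJ * ε₀ * eta F n K ^ 2) (hX₂ : ∀ μ x, ‖X₂ μ x‖ ≤ p * θ₂ * nY * eta F n K ^ 2)
    (hX₃ : ∀ μ x, ‖X₃ μ x‖ ≤ p * C₄ * nY ^ 2 * eta F n K ^ 2) (hn : nY ≤ B₁ / 2 * ε₀)
    (hYop : ∀ μ x, ‖Yop μ x‖ ≤ bop * m * eta F n K ^ 2) (hm0 : ∀ b, ‖Y0 b‖ ≤ m) (hm : m ≤ s * ε₀)
    (h130 : ∀ ν x, ‖covLapFormT 1 (bgUnits F K U₀) YH ν x‖ ≤ BΔ * nB * eta F n K ^ 2) (hB : nB ≤ cB * ε₀)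
    (ν : Fin (F.P K).d) (x : Site (F.P K) 0) :
    ‖covLapFormT 1 (bgUnits F K U₀) Y ν x‖
      ≤ (p * (cJ + θ₂ * B₁ / 2 + C₄ * B₁ ^ 2 * ε₀ / 4) + (bop + 4 * ε₀) * s + BΔ * cB) * ε₀ * eta F n K ^ 2 := by
  have hη2 : 0 ≤ eta F n K ^ 2 := sq_nonneg _
  -- (135) + (14) for `Y0`: `Δ¹Y0 = (D*D + DD*)Y0 + 𝒦Y0`, `‖𝒦Y0‖ ≤ 4ε₀η²·m`
  have hK : ‖curvOp (torusT (F.P K) 0) (fun μ x => bgUnits F K U₀ ⟨x, μ⟩) (formComp Y0) ν x‖ ≤ 2 * (((F.P K).d : ℝ) - 1) * (ε₀ * eta F n K ^ 2) * m := by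
    have h := norm_curvOp_formComp_le (bgUnits F K U₀) (norm_bgUnits_le_one F K U₀)
      (norm_plaqFT_bgUnits_sub_one_le F K U₀ hU₀.plaqSmall) hm0 ν x
    have hreg : T3RegularMinimiser.regThreshold F n K ε₀ = ε₀ * eta F n K ^ 2 := by
      rw [T3RegularMinimiser.regThreshold, eta, ← pow_mul, mul_comm 2 (K - n)]
    rwa [hreg] at h
  have hd : (((F.P K).d : ℝ) - 1) = 2 := by rw [T3Family.P_d]; norm_num
  rw [hd] at hK
  have hL0 : covLapFormT 1 (bgUnits F K U₀) Y0 ν x = (-J' ν x + X₂ ν x - X₃ ν x - Yop ν x)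
      + curvOp (torusT (F.P K) 0) (fun μ x => bgUnits F K U₀ ⟨x, μ⟩) (formComp Y0) ν x := by
    rw [covLapFormT_eq_covCodiffCurlT_add, h133]
  -- the size bookkeeping of `rhs133_bound` ∕ `lapA0_bound` ∕ `ineq136`
  have hm' : 0 ≤ m := (norm_nonneg _).trans (hm0 ⟨x, ν⟩)
  have h0 : ‖covLapFormT 1 (bgUnits F K U₀) Y0 ν x‖
      ≤ ‖J' ν x‖ + ‖X₂ ν x‖ + ‖X₃ ν x‖ + ‖Yop ν x‖ + 2 * 2 * (ε₀ * eta F n K ^ 2) * m := by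
    rw [hL0]
    refine (norm_add_le _ _).trans (add_le_add ?_ hK)
    calc ‖-J' ν x + X₂ ν x - X₃ ν x - Yop ν x‖ ≤ ‖-J' ν x + X₂ ν x - X₃ ν x‖ + ‖Yop ν x‖ := norm_sub_le _ _
      _ ≤ ‖-J' ν x + X₂ ν x‖ + ‖X₃ ν x‖ + ‖Yop ν x‖ := by gcongr; exact norm_sub_le _ _
      _ ≤ ‖-J' ν x‖ + ‖X₂ ν x‖ + ‖X₃ ν x‖ + ‖Yop ν x‖ := by gcongr; exact norm_add_le _ _
      _ = ‖J' ν x‖ + ‖X₂ ν x‖ + ‖X₃ ν x‖ + ‖Yop ν x‖ := by rw [norm_neg]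
  have hsplitν : covLapFormT 1 (bgUnits F K U₀) Y ν x = covLapFormT 1 (bgUnits F K U₀) Y0 ν x + covLapFormT 1 (bgUnits F K U₀) YH ν x := by
    rw [hsplit, Prop7NMax19Algebra.covLapFormT_add]
  have h1 : ‖covLapFormT 1 (bgUnits F K U₀) Y ν x‖ ≤ ‖covLapFormT 1 (bgUnits F K U₀) Y0 ν x‖ + ‖covLapFormT 1 (bgUnits F K U₀) YH ν x‖ := by
    rw [hsplitν]; exact norm_add_le _ _
  -- collect
  have hJ' := hJ ν x
  have hX₂' := hX₂ ν x
  have hX₃' := hX₃ ν x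
  have hYop' := hYop ν x
  have h130' := h130 ν x
  have hnY2 : nY ^ 2 ≤ (B₁ / 2 * ε₀) ^ 2 := pow_le_pow_left₀ hnY hn 2
  have e1 : p * θ₂ * nY * eta F n K ^ 2 ≤ p * θ₂ * (B₁ / 2 * ε₀) * eta F n K ^ 2 :=
    mul_le_mul_of_nonneg_right (mul_le_mul_of_nonneg_left hn (mul_nonneg hp hθ₂)) hη2
  have e2 : p * C₄ * nY ^ 2 * eta F n K ^ 2 ≤ p * C₄ * (B₁ / 2 * ε₀) ^ 2 * eta F n K ^ 2 :=
    mul_le_mul_of_nonneg_right (mul_le_mul_of_nonneg_left hnY2 (mul_nonneg hp hC₄)) hη2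
  have e3 : bop * m * eta F n K ^ 2 ≤ bop * (s * ε₀) * eta F n K ^ 2 :=
    mul_le_mul_of_nonneg_right (mul_le_mul_of_nonneg_left hm hbop) hη2
  have e4 : 2 * 2 * (ε₀ * eta F n K ^ 2) * m ≤ 2 * 2 * (ε₀ * eta F n K ^ 2) * (s * ε₀) :=
    mul_le_mul_of_nonneg_left hm (by positivity)
  have e5 : BΔ * nB * eta F n K ^ 2 ≤ BΔ * (cB * ε₀) * eta F n K ^ 2 :=
    mul_le_mul_of_nonneg_right (mul_le_mul_of_nonneg_left hB hBΔ) hη2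
  have key : ‖covLapFormT 1 (bgUnits F K U₀) Y ν x‖
      ≤ p * cJ * ε₀ * eta F n K ^ 2 + p * θ₂ * (B₁ / 2 * ε₀) * eta F n K ^ 2 + p * C₄ * (B₁ / 2 * ε₀) ^ 2 * eta F n K ^ 2
        + bop * (s * ε₀) * eta F n K ^ 2 + 2 * 2 * (ε₀ * eta F n K ^ 2) * (s * ε₀) + BΔ * (cB * ε₀) * eta F n K ^ 2 := by
    linarith
  refine key.trans (le_of_eq ?_)
  ring

/-- ★★ **THE `D¹*D¹` MEMBER FOR THE `A′₁`-PIECE** — (140)'s mechanism «we use again the formula (135), and the fact that DPD* is a bounded operator» applied to `A′₁` itself: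
from the Laplacian bound of `norm_covLapFormT_le_of_rows136`, the (3.49)-row for `D¹(D¹*Y)` (`hDDY`, Landau field) and the (14)-clause (✓`norm_covCodiffCurlT_sub_covLapFormT_add_gradDiv_le_of_regPr`,
`4ε₀η²·n`): `‖(D¹*D¹_{U₀}Y)_μ(x)‖ ≤ (O₁₃₆ + k₄B₁∕2 + 2B₁ε₀)·ε₀·η²`. [cite: Balaban1985Variational, (19) p.281, (135)–(136) p.298, (140) p.299; Balaban1985BackgroundPropagators, (3.49) p.399] -/
theorem norm_covCodiffCurlT_le_of_rows136 {ε₀ : ℝ} (hε₀ : 0 ≤ ε₀) (U₀ : GaugeField (F.P K) 0 (Matrix.specialUnitaryGroup (Fin 2) ℂ)) (hU₀ : RegPr F n K ε₀ U₀)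
    (Y Y0 YH : PBond (F.P K) 0 → Matrix (Fin 2) (Fin 2) ℂ) (hsplit : Y = Y0 + YH)
    (J' X₂ X₃ Yop : Fin (F.P K).d → Site (F.P K) 0 → Matrix (Fin 2) (Fin 2) ℂ)
    (h133 : ∀ (μ : Fin (F.P K).d) (x : Site (F.P K) 0),
      covCodiffCurlT 1 (bgUnits F K U₀) Y0 μ x + covDerivFwdT 1 (bgUnits F K U₀) μ (covDivFormT 1 (bgUnits F K U₀) Y0) x
        = -J' μ x + X₂ μ x - X₃ μ x - Yop μ x)
    {p cJ θ₂ C₄ B₁ nY bop m s BΔ nB cB k₄ : ℝ} (hp : 0 ≤ p) (hθ₂ : 0 ≤ θ₂) (hC₄ : 0 ≤ C₄) (hnY : 0 ≤ nY) (hbop : 0 ≤ bop) (hBΔ : 0 ≤ BΔ) (hk₄ : 0 ≤ k₄)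
    (hJ : ∀ μ x, ‖J' μ x‖ ≤ p * cJ * ε₀ * eta F n K ^ 2) (hX₂ : ∀ μ x, ‖X₂ μ x‖ ≤ p * θ₂ * nY * eta F n K ^ 2)
    (hX₃ : ∀ μ x, ‖X₃ μ x‖ ≤ p * C₄ * nY ^ 2 * eta F n K ^ 2) (hn : nY ≤ B₁ / 2 * ε₀) (hYsup : ∀ b, ‖Y b‖ ≤ nY)
    (hYop : ∀ μ x, ‖Yop μ x‖ ≤ bop * m * eta F n K ^ 2) (hm0 : ∀ b, ‖Y0 b‖ ≤ m) (hm : m ≤ s * ε₀)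
    (h130 : ∀ ν x, ‖covLapFormT 1 (bgUnits F K U₀) YH ν x‖ ≤ BΔ * nB * eta F n K ^ 2) (hB : nB ≤ cB * ε₀)
    (hDDY : ∀ μ x, ‖covDerivFwdT 1 (bgUnits F K U₀) μ (covDivFormT 1 (bgUnits F K U₀) Y) x‖ ≤ k₄ * nY * eta F n K ^ 2)
    (μ : Fin (F.P K).d) (x : Site (F.P K) 0) :
    ‖covCodiffCurlT 1 (bgUnits F K U₀) Y μ x‖
      ≤ (p * (cJ + θ₂ * B₁ / 2 + C₄ * B₁ ^ 2 * ε₀ / 4) + (bop + 4 * ε₀) * s + BΔ * cB + k₄ * B₁ / 2 + 2 * B₁ * ε₀) * ε₀ * eta F n K ^ 2 := by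
  have hLap := norm_covLapFormT_le_of_rows136 F n K hε₀ U₀ hU₀ Y Y0 YH hsplit J' X₂ X₃ Yop h133 hp hθ₂ hC₄ hnY hbop hBΔ hJ hX₂ hX₃ hn hYop hm0 hm h130 hB μ x
  have hW := norm_covCodiffCurlT_sub_covLapFormT_add_gradDiv_le_of_regPr F n K U₀ hU₀ hYsup μ x
  have hDD := hDDY μ x
  have htri : ‖covCodiffCurlT 1 (bgUnits F K U₀) Y μ x‖
      ≤ ‖covCodiffCurlT 1 (bgUnits F K U₀) Y μ x
            - (covLapFormT 1 (bgUnits F K U₀) Y μ x - covDerivFwdT 1 (bgUnits F K U₀) μ (covDivFormT 1 (bgUnits F K U₀) Y) x)‖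
        + (‖covLapFormT 1 (bgUnits F K U₀) Y μ x‖ + ‖covDerivFwdT 1 (bgUnits F K U₀) μ (covDivFormT 1 (bgUnits F K U₀) Y) x‖) := by
    have := norm_add_le (covCodiffCurlT 1 (bgUnits F K U₀) Y μ x
            - (covLapFormT 1 (bgUnits F K U₀) Y μ x - covDerivFwdT 1 (bgUnits F K U₀) μ (covDivFormT 1 (bgUnits F K U₀) Y) x))
      (covLapFormT 1 (bgUnits F K U₀) Y μ x - covDerivFwdT 1 (bgUnits F K U₀) μ (covDivFormT 1 (bgUnits F K U₀) Y) x)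
    rw [sub_add_cancel] at this
    exact this.trans (add_le_add le_rfl (norm_sub_le _ _))
  have hη2 : 0 ≤ eta F n K ^ 2 := sq_nonneg _
  have e6 : 4 * ε₀ * eta F n K ^ 2 * nY ≤ 4 * ε₀ * eta F n K ^ 2 * (B₁ / 2 * ε₀) := mul_le_mul_of_nonneg_left hn (by positivity)
  have e7 : k₄ * nY * eta F n K ^ 2 ≤ k₄ * (B₁ / 2 * ε₀) * eta F n K ^ 2 :=
    mul_le_mul_of_nonneg_right (mul_le_mul_of_nonneg_left hn hk₄) hη2
  have key : ‖covCodiffCurlT 1 (bgUnits F K U₀) Y μ x‖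
      ≤ 4 * ε₀ * eta F n K ^ 2 * (B₁ / 2 * ε₀)
        + ((p * (cJ + θ₂ * B₁ / 2 + C₄ * B₁ ^ 2 * ε₀ / 4) + (bop + 4 * ε₀) * s + BΔ * cB) * ε₀ * eta F n K ^ 2 + k₄ * (B₁ / 2 * ε₀) * eta F n K ^ 2) := by
    linarith
  refine key.trans (le_of_eq ?_)
  ring

/-! ## §2 (v1.2 APPEND) THE SAME WITHOUT THE SPLIT (129) AND WITHOUT THE (130) ROW — located at the one-level member

WHY NO (129)∕(130) AT THE MEMBER.  (128) on `ker Q` gives `Δ_aA′₁ ∈ −J + Δ⁽²⁾A′₁ − V′(A′₁) + range Q*`; applying `G = Δ_a⁻¹` and `QA′₁ = B̃` fixes the `range Q*` component: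
`Δ_aA′₁ = P₀*(−J + Δ⁽²⁾A′₁ − V′(A′₁)) + Q*(QGQ*)⁻¹B̃` — print's (133) for `A₀` PLUS (129)'s `Δ_aH₀B = Q*(QGQ*)⁻¹B̃` (✓`Prop7SectET3H137Rows.laplaceA_HT_pi`), no split.  The Landau
condition (21) `RD*A′₁ = 0` kills `DRD*A′₁` outright and `Q*aQA′₁ = aQ*B̃`, so `ΔA′₁ = RHS(133) + Q*((QGQ*)⁻¹ − a)B̃` — the last term is EXACTLY the block letter of (137).  With [5] (3.10)
`Δ = D*D + Δ′` this is the `D*D` member; with (135) `Δ_{U₀} = D*D + DD* + 𝒦`, `DD*A′₁ = DPD*A′₁` ((21) again) and (14) it is the `Δ_{U₀}` member.  So the second-order Green's-function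
entry (3.42)₃ behind (130) is NOT an input at the one-level member.  DISPLAYED ROWS of the two `_noSplit` theorems (locus → supplier → inhabitability line):
`hEq : D¹*D¹_{U₀}Y = −J′ + X₂ − X₃ + X137 − YΔ` [(128)+(21)+(3.10) resolved; `X137 = η²·Q*((QGQ*)⁻¹ − a)B̃`, `YΔ = η²·Δ′A′₁`; supplier ✓`Prop7Crit127OfCrit93Split` door + the member-level
(128)⇒(133) algebra + ✓`laplaceA_HT_pi` + «Δ310-EXPLICIT» ✓`Prop7SectET3ActionQuad`∕`…HessFormExplicit`∕`…DeltaEtaExplicit` (★px5); CHECK: identity DEFINING `YΔ`] · `hJ hX₂ hX₃ hn hYsup` as in §1 ·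
`h137 : ‖X137 μ x‖ ≤ c₁₃₇·nB·η²`, `hB : nB ≤ cB·ε₀` [(137)'s block letter sup row (★px5's displayed `h137`), (20)∕(75); CHECK: `B̃ = 0`] · `hΔp : ‖YΔ μ x‖ ≤ k₃·nY·η²` [[5] (3.10)∕(3.69) op-norm, =
★px5's `h310` species; CHECK: `Y = 0`] · `hDPD : ‖D¹(D¹*Y) μ x‖ ≤ k₄·nY·η²` [[5] (3.49) at `Y` via (21); CHECK: `Y = 0`]. [cite: Balaban1985Variational, (128) p.297, (133)–(137) p.298] -/

/-- ★★ **THE `D¹*D¹` MEMBER OF (19) FOR `Y = ι(A′₁)` FROM THE DISPLAYED ROWS** — (128) resolved on `ker Q` and read through [5] (3.10): `D*DA′₁ = −P₀*J + P₀*Δ⁽²⁾A′₁ − P₀*V′(A′₁)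
+ Q*((QGQ*)⁻¹ − a)B̃ − Δ′A′₁` (`hEq`), with the bound rows (28)∕(3.137)∕(97) behind `P₀*` (`hJ hX₂ hX₃`, sizes `hn`), (137)'s block letter (`h137`, `hB`) and (3.69) (`hΔp`):
`‖(D¹*D¹_{U₀}Y)_μ(x)‖ ≤ (p(cJ + θ₂B₁∕2 + C₄B₁²ε₀∕4) + c₁₃₇cB + k₃B₁∕2)·ε₀·η²`. [cite: Balaban1985Variational, (128) p.297, (133) p.298, (137) p.298, (28) p.282, (97) p.293; Balaban1985BackgroundPropagators, (3.10) p.392, (3.137) p.424, (3.69) p.404] -/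
theorem norm_covCodiffCurlT_le_of_rows136_noSplit {ε₀ : ℝ} (U₀ : GaugeField (F.P K) 0 (Matrix.specialUnitaryGroup (Fin 2) ℂ))
    (Y : PBond (F.P K) 0 → Matrix (Fin 2) (Fin 2) ℂ) (J' X₂ X₃ X137 YΔ : Fin (F.P K).d → Site (F.P K) 0 → Matrix (Fin 2) (Fin 2) ℂ)
    (hEq : ∀ (μ : Fin (F.P K).d) (x : Site (F.P K) 0), covCodiffCurlT 1 (bgUnits F K U₀) Y μ x = -J' μ x + X₂ μ x - X₃ μ x + X137 μ x - YΔ μ x)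
    {p cJ θ₂ C₄ B₁ nY c₁₃₇ nB cB k₃ : ℝ} (hp : 0 ≤ p) (hθ₂ : 0 ≤ θ₂) (hC₄ : 0 ≤ C₄) (hnY : 0 ≤ nY) (hc : 0 ≤ c₁₃₇) (hk₃ : 0 ≤ k₃)
    (hJ : ∀ μ x, ‖J' μ x‖ ≤ p * cJ * ε₀ * eta F n K ^ 2) (hX₂ : ∀ μ x, ‖X₂ μ x‖ ≤ p * θ₂ * nY * eta F n K ^ 2)
    (hX₃ : ∀ μ x, ‖X₃ μ x‖ ≤ p * C₄ * nY ^ 2 * eta F n K ^ 2) (hn : nY ≤ B₁ / 2 * ε₀)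
    (h137 : ∀ μ x, ‖X137 μ x‖ ≤ c₁₃₇ * nB * eta F n K ^ 2) (hB : nB ≤ cB * ε₀) (hΔp : ∀ μ x, ‖YΔ μ x‖ ≤ k₃ * nY * eta F n K ^ 2)
    (μ : Fin (F.P K).d) (x : Site (F.P K) 0) :
    ‖covCodiffCurlT 1 (bgUnits F K U₀) Y μ x‖ ≤ (p * (cJ + θ₂ * B₁ / 2 + C₄ * B₁ ^ 2 * ε₀ / 4) + c₁₃₇ * cB + k₃ * B₁ / 2) * ε₀ * eta F n K ^ 2 := by
  have hη2 : 0 ≤ eta F n K ^ 2 := sq_nonneg _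
  have h0 : ‖covCodiffCurlT 1 (bgUnits F K U₀) Y μ x‖ ≤ ‖J' μ x‖ + ‖X₂ μ x‖ + ‖X₃ μ x‖ + ‖X137 μ x‖ + ‖YΔ μ x‖ := by
    rw [hEq]
    calc ‖-J' μ x + X₂ μ x - X₃ μ x + X137 μ x - YΔ μ x‖ ≤ ‖-J' μ x + X₂ μ x - X₃ μ x + X137 μ x‖ + ‖YΔ μ x‖ := norm_sub_le _ _
      _ ≤ ‖-J' μ x + X₂ μ x - X₃ μ x‖ + ‖X137 μ x‖ + ‖YΔ μ x‖ := by gcongr; exact norm_add_le _ _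
      _ ≤ ‖-J' μ x + X₂ μ x‖ + ‖X₃ μ x‖ + ‖X137 μ x‖ + ‖YΔ μ x‖ := by gcongr; exact norm_sub_le _ _
      _ ≤ ‖-J' μ x‖ + ‖X₂ μ x‖ + ‖X₃ μ x‖ + ‖X137 μ x‖ + ‖YΔ μ x‖ := by gcongr; exact norm_add_le _ _
      _ = ‖J' μ x‖ + ‖X₂ μ x‖ + ‖X₃ μ x‖ + ‖X137 μ x‖ + ‖YΔ μ x‖ := by rw [norm_neg]
  have hnY2 : nY ^ 2 ≤ (B₁ / 2 * ε₀) ^ 2 := pow_le_pow_left₀ hnY hn 2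
  have e1 : p * θ₂ * nY * eta F n K ^ 2 ≤ p * θ₂ * (B₁ / 2 * ε₀) * eta F n K ^ 2 :=
    mul_le_mul_of_nonneg_right (mul_le_mul_of_nonneg_left hn (mul_nonneg hp hθ₂)) hη2
  have e2 : p * C₄ * nY ^ 2 * eta F n K ^ 2 ≤ p * C₄ * (B₁ / 2 * ε₀) ^ 2 * eta F n K ^ 2 :=
    mul_le_mul_of_nonneg_right (mul_le_mul_of_nonneg_left hnY2 (mul_nonneg hp hC₄)) hη2
  have e3 : c₁₃₇ * nB * eta F n K ^ 2 ≤ c₁₃₇ * (cB * ε₀) * eta F n K ^ 2 :=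
    mul_le_mul_of_nonneg_right (mul_le_mul_of_nonneg_left hB hc) hη2
  have e4 : k₃ * nY * eta F n K ^ 2 ≤ k₃ * (B₁ / 2 * ε₀) * eta F n K ^ 2 :=
    mul_le_mul_of_nonneg_right (mul_le_mul_of_nonneg_left hn hk₃) hη2
  have key : ‖covCodiffCurlT 1 (bgUnits F K U₀) Y μ x‖
      ≤ p * cJ * ε₀ * eta F n K ^ 2 + p * θ₂ * (B₁ / 2 * ε₀) * eta F n K ^ 2 + p * C₄ * (B₁ / 2 * ε₀) ^ 2 * eta F n K ^ 2
        + c₁₃₇ * (cB * ε₀) * eta F n K ^ 2 + k₃ * (B₁ / 2 * ε₀) * eta F n K ^ 2 := by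
    linarith [hJ μ x, hX₂ μ x, hX₃ μ x, h137 μ x, hΔp μ x]
  refine key.trans (le_of_eq ?_)
  ring

/-- ★★ **(136) — THE COVARIANT-LAPLACIAN MEMBER OF (19) FOR `Y = ι(A′₁)`**: from the `D¹*D¹` bound above, (3.49) for the gradient-of-divergence `D¹(D¹*Y) = D¹(P_SD¹*Y)` ((21), row `hDPD`)
and the THEOREM (135) + (14) (✓`Prop7SecondOrderDict.covLapFormT_eq_covCodiffCurlT_add`, curvature `≤ 4ε₀η²·nY` on `RegPr` by ✓`norm_curvOp_formComp_le`):
`‖(Δ¹_{U₀}Y)_ν(x)‖ ≤ (O_{D*D} + k₄B₁∕2 + 2B₁ε₀)·ε₀·η²`. [cite: Balaban1985Variational, (135)–(136) p.298, (140) p.299, (14) p.280; Balaban1985BackgroundPropagators, (3.49) p.399] -/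
theorem norm_covLapFormT_le_of_rows136_noSplit {ε₀ : ℝ} (hε₀ : 0 ≤ ε₀) (U₀ : GaugeField (F.P K) 0 (Matrix.specialUnitaryGroup (Fin 2) ℂ)) (hU₀ : RegPr F n K ε₀ U₀)
    (Y : PBond (F.P K) 0 → Matrix (Fin 2) (Fin 2) ℂ) (J' X₂ X₃ X137 YΔ : Fin (F.P K).d → Site (F.P K) 0 → Matrix (Fin 2) (Fin 2) ℂ)
    (hEq : ∀ (μ : Fin (F.P K).d) (x : Site (F.P K) 0), covCodiffCurlT 1 (bgUnits F K U₀) Y μ x = -J' μ x + X₂ μ x - X₃ μ x + X137 μ x - YΔ μ x)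
    {p cJ θ₂ C₄ B₁ nY c₁₃₇ nB cB k₃ k₄ : ℝ} (hp : 0 ≤ p) (hθ₂ : 0 ≤ θ₂) (hC₄ : 0 ≤ C₄) (hnY : 0 ≤ nY) (hc : 0 ≤ c₁₃₇) (hk₃ : 0 ≤ k₃) (hk₄ : 0 ≤ k₄)
    (hJ : ∀ μ x, ‖J' μ x‖ ≤ p * cJ * ε₀ * eta F n K ^ 2) (hX₂ : ∀ μ x, ‖X₂ μ x‖ ≤ p * θ₂ * nY * eta F n K ^ 2)
    (hX₃ : ∀ μ x, ‖X₃ μ x‖ ≤ p * C₄ * nY ^ 2 * eta F n K ^ 2) (hn : nY ≤ B₁ / 2 * ε₀) (hYsup : ∀ b, ‖Y b‖ ≤ nY)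
    (h137 : ∀ μ x, ‖X137 μ x‖ ≤ c₁₃₇ * nB * eta F n K ^ 2) (hB : nB ≤ cB * ε₀) (hΔp : ∀ μ x, ‖YΔ μ x‖ ≤ k₃ * nY * eta F n K ^ 2)
    (hDPD : ∀ μ x, ‖covDerivFwdT 1 (bgUnits F K U₀) μ (covDivFormT 1 (bgUnits F K U₀) Y) x‖ ≤ k₄ * nY * eta F n K ^ 2)
    (ν : Fin (F.P K).d) (x : Site (F.P K) 0) :
    ‖covLapFormT 1 (bgUnits F K U₀) Y ν x‖
      ≤ (p * (cJ + θ₂ * B₁ / 2 + C₄ * B₁ ^ 2 * ε₀ / 4) + c₁₃₇ * cB + k₃ * B₁ / 2 + k₄ * B₁ / 2 + 2 * B₁ * ε₀) * ε₀ * eta F n K ^ 2 := by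
  have hη2 : 0 ≤ eta F n K ^ 2 := sq_nonneg _
  have hDD := norm_covCodiffCurlT_le_of_rows136_noSplit F n K U₀ Y J' X₂ X₃ X137 YΔ hEq hp hθ₂ hC₄ hnY hc hk₃ hJ hX₂ hX₃ hn h137 hB hΔp ν x
  -- (135): `Δ¹Y = D*DY + D(D*Y) + 𝒦Y`, and (14): `‖𝒦Y‖ ≤ 2(d−1)·(ε₀η²)·nY`, `d = 3`
  have hK : ‖curvOp (torusT (F.P K) 0) (fun μ x => bgUnits F K U₀ ⟨x, μ⟩) (formComp Y) ν x‖ ≤ 2 * (((F.P K).d : ℝ) - 1) * (ε₀ * eta F n K ^ 2) * nY := by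
    have h := norm_curvOp_formComp_le (bgUnits F K U₀) (norm_bgUnits_le_one F K U₀)
      (norm_plaqFT_bgUnits_sub_one_le F K U₀ hU₀.plaqSmall) hYsup ν x
    have hreg : T3RegularMinimiser.regThreshold F n K ε₀ = ε₀ * eta F n K ^ 2 := by
      rw [T3RegularMinimiser.regThreshold, eta, ← pow_mul, mul_comm 2 (K - n)]
    rwa [hreg] at h
  have hd : (((F.P K).d : ℝ) - 1) = 2 := by rw [T3Family.P_d]; norm_num
  rw [hd] at hK
  have h1 : ‖covLapFormT 1 (bgUnits F K U₀) Y ν x‖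
      ≤ ‖covCodiffCurlT 1 (bgUnits F K U₀) Y ν x‖ + ‖covDerivFwdT 1 (bgUnits F K U₀) ν (covDivFormT 1 (bgUnits F K U₀) Y) x‖
        + ‖curvOp (torusT (F.P K) 0) (fun μ x => bgUnits F K U₀ ⟨x, μ⟩) (formComp Y) ν x‖ := by
    rw [covLapFormT_eq_covCodiffCurlT_add]
    exact (norm_add_le _ _).trans (add_le_add (norm_add_le _ _) le_rfl)
  have e5 : k₄ * nY * eta F n K ^ 2 ≤ k₄ * (B₁ / 2 * ε₀) * eta F n K ^ 2 :=
    mul_le_mul_of_nonneg_right (mul_le_mul_of_nonneg_left hn hk₄) hη2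
  have e6 : 2 * 2 * (ε₀ * eta F n K ^ 2) * nY ≤ 2 * 2 * (ε₀ * eta F n K ^ 2) * (B₁ / 2 * ε₀) := mul_le_mul_of_nonneg_left hn (by positivity)
  have key : ‖covLapFormT 1 (bgUnits F K U₀) Y ν x‖
      ≤ (p * (cJ + θ₂ * B₁ / 2 + C₄ * B₁ ^ 2 * ε₀ / 4) + c₁₃₇ * cB + k₃ * B₁ / 2) * ε₀ * eta F n K ^ 2
        + k₄ * (B₁ / 2 * ε₀) * eta F n K ^ 2 + 2 * 2 * (ε₀ * eta F n K ^ 2) * (B₁ / 2 * ε₀) := by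
    linarith [hDPD ν x]
  refine key.trans (le_of_eq ?_)
  ring

end Summit.QuantumFields.YangMills.Theorems.Prop7HDsolOfRows

end
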